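import Mathlib
import HarnessLib

/-!
# Route `CylinderEntropy`, item `ImmortalAreaToFloor` (stmt-SmoothPoincare4-17197):
# the CUBE TELESCOPING lemma — a weak relative isoperimetric inequality in a box of `ℝⁿ⁺¹`
# through the topological frontier

Brick (TEL) of the Allard-free blueprint for the residual `ThinSeq` of the item (evidence
`ANALYSIS-prover-17197-c1.md`, §6): in the per-ball lemma, columns with `L¹`-far material profiles disagree
at many levels `c`, and at each such level every COORDINATE PATH between them crosses the frontier of the
horizontal slice `U_c` of the material region; integrating over pairs of columns bounds the product of the two
populations by the size of the frontier.  This file PROVES that integration step, in `Fin (n+1) → ℝ` with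
Lebesgue measure and a closed box `Q = Icc a b`:

* `exists_mem_frontier_update` — a coordinate segment from a point of an open set `U` to a point outside `U`
  meets `frontier U` (connectedness of the segment);
* `exists_switch` — along the `(n+1)`-step coordinate path `p₀ = x, …, p_{n+1} = y` (replace the coordinates
  of `x` by those of `y` one at a time) from `x ∈ U` to `y ∉ U` some step switches;
* `prod_subset_iUnion` — hence `(U ∩ Q) × (Q ∖ U) ⊆ ⋃ⱼ Cⱼ`, `Cⱼ` = pairs whose `j`-th path point has its
  `j`-deleted coordinates in the `j`-deleted shadow of `frontier U ∩ Q`;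
* `volume_pathSet_le` — `vol(Cⱼ) ≤ (bⱼ - aⱼ) · volₙ(shadowⱼ) · vol(Q)`: the map
  `(x, y) ↦ (pⱼ(x,y), p'ⱼ(x,y))` swapping the first `j` coordinates of `x` and `y` preserves Lebesgue measure
  on `(Fin (n+1) → ℝ)²` (`volume_preserving_pi` of coordinatewise swaps, transported along
  `arrowProdEquivProdArrow`), and `{w ∈ Q | removeNth j w ∈ A}` has measure `(bⱼ - aⱼ) volₙ(A ∩ Q̂)`
  (`volume_preserving_piFinSuccAbove`);
* `volume_image_removeNth_le_hausdorffMeasure` — `volₙ(removeNth j '' S) ≤ μH[n] S` (the coordinate deletion is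
  `1`-Lipschitz for the sup norm; `hausdorffMeasure_pi_real`);
* **`volume_inter_mul_volume_diff_le`** — the telescoping inequality
  `vol(U ∩ Q) · vol(Q ∖ U) ≤ vol(Q) · (∑ⱼ (bⱼ - aⱼ)) · μH[n](frontier U ∩ Q)` for every open `U`.

Everything is proved; no definition (the path map is an explicit lambda), no named fact.

References: H. Federer, *Geometric Measure Theory* (1969), 4.5.3 (relative isoperimetric inequality; this is the
elementary weak form through the topological boundary); L. C. Evans, R. F. Gariepy, *Measure theory and fine
properties of functions* (1992), §5.6.2.
-/

noncomputable section

-- the prescribed namespace `Summit.SmoothPoincare4.SmoothPoincare4.…` repeats `SmoothPoincare4`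
set_option linter.dupNamespace false

open MeasureTheory Set Function Filter
open scoped ENNReal NNReal Topology BigOperators

namespace Summit.SmoothPoincare4.SmoothPoincare4.Theorems.CubeTelescoping

variable {n : ℕ}

/-! ## The coordinate path -/

section Path

variable (p : ℕ → (Fin (n + 1) → ℝ) → (Fin (n + 1) → ℝ) → (Fin (n + 1) → ℝ))
  (hp : ∀ j x y i, p j x y i = if (i : ℕ) < j then y i else x i)
include hp

/-- The path starts at `x`. [folklore] -/
theorem path_zero (x y : Fin (n + 1) → ℝ) : p 0 x y = x := by
  funext i; rw [hp]; simp

/-- The path ends at `y`. [folklore] -/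
theorem path_last (x y : Fin (n + 1) → ℝ) : p (n + 1) x y = y := by
  funext i; rw [hp]; simp [i.is_lt]

/-- Every path point of two points of the box `Icc a b` lies in the box. [folklore] -/
theorem path_mem_Icc {a b x y : Fin (n + 1) → ℝ} (hx : x ∈ Icc a b) (hy : y ∈ Icc a b) (j : ℕ) :
    p j x y ∈ Icc a b := by
  rw [mem_Icc, Pi.le_def, Pi.le_def] at hx hy ⊢
  refine ⟨fun i => ?_, fun i => ?_⟩ <;> rw [hp] <;> split_ifs
  exacts [hy.1 i, hx.1 i, hy.2 i, hx.2 i]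

/-- Consecutive path points differ in one coordinate: `p_{j+1} = update p_j j (y j)`. [folklore] -/
theorem path_succ_eq_update (x y : Fin (n + 1) → ℝ) (j : Fin (n + 1)) :
    p ((j : ℕ) + 1) x y = update (p j x y) j (y j) := by
  funext i
  by_cases hij : i = j
  · subst hij
    rw [update_self, hp]
    simp
  · rw [update_of_ne hij, hp, hp]
    have hne : (i : ℕ) ≠ (j : ℕ) := fun h => hij (Fin.ext h)
    by_cases hlt : (i : ℕ) < (j : ℕ)
    · rw [if_pos (Nat.lt_succ_of_lt hlt), if_pos hlt]
    · rw [if_neg hlt, if_neg (by omega)]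

/-- The complementary path point `p'_j` (first `j` coordinates from `x`, the rest from `y`) together with
`p_j` determines the pair: `x i` is `p_j i` or `p'_j i`, and so is `y i`. Used through the swap map below.
[folklore] -/
theorem path_swap_swap (x y : Fin (n + 1) → ℝ) (j : ℕ) :
    p j (p j x y) (p j y x) = x ∧ p j (p j y x) (p j x y) = y := by
  constructor <;> funext i <;> rw [hp, hp, hp] <;> split_ifs <;> rfl

/-- **Some step of the coordinate path from a point of `U` to a point outside `U` switches.** [folklore] -/
theorem exists_switch {U : Set (Fin (n + 1) → ℝ)} {x y : Fin (n + 1) → ℝ} (hx : x ∈ U) (hy : y ∉ U) :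
    ∃ j : Fin (n + 1), p j x y ∈ U ∧ p ((j : ℕ) + 1) x y ∉ U := by
  classical
  have hex : ∃ k : ℕ, p k x y ∉ U := ⟨n + 1, by rwa [path_last p hp]⟩
  set k := Nat.find hex with hk
  have hkU : p k x y ∉ U := Nat.find_spec hex
  have hk0 : k ≠ 0 := by
    intro h0
    rw [h0, path_zero p hp] at hkU
    exact hkU hx
  have hkle : k ≤ n + 1 := Nat.find_min' hex (by rwa [path_last p hp])
  refine ⟨⟨k - 1, by omega⟩, ?_, ?_⟩
  · have hmin := Nat.find_min hex (m := k - 1) (by omega)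
    simpa using hmin
  · have : ((⟨k - 1, by omega⟩ : Fin (n + 1)) : ℕ) + 1 = k := by
      simp only; omega
    rw [this]
    exact hkU

end Path

/-! ## A coordinate segment leaving an open set meets its frontier -/

/-- **A coordinate segment from a point of an open set `U` to a point outside `U` meets `frontier U`**
(the segment is connected; `IsPreconnected.subset_of_closure_inter_subset`). The frontier point has its moving
coordinate in the closed interval between the two end values. [folklore] -/
theorem exists_mem_frontier_update {U : Set (Fin (n + 1) → ℝ)} (hU : IsOpen U) {w : Fin (n + 1) → ℝ}
    (hw : w ∈ U) (j : Fin (n + 1)) {s : ℝ} (hs : update w j s ∉ U) :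
    ∃ r ∈ uIcc (w j) s, update w j r ∈ frontier U := by
  classical
  set γ : ℝ → (Fin (n + 1) → ℝ) := fun r => update w j r with hγ
  have hγc : Continuous γ := continuous_const.update j continuous_id
  have hconn : IsPreconnected (γ '' uIcc (w j) s) := isPreconnected_uIcc.image γ hγc.continuousOn
  have hwmem : w ∈ γ '' uIcc (w j) s := ⟨w j, left_mem_uIcc, by simp [hγ]⟩
  by_contra hcon
  simp only [not_exists, not_and] at hcon
  have hsub : γ '' uIcc (w j) s ⊆ U := by
    refine hconn.subset_of_closure_inter_subset hU ⟨w, hwmem, hw⟩ ?_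
    rintro z ⟨hzcl, ⟨r, hr, rfl⟩⟩
    rw [closure_eq_self_union_frontier] at hzcl
    rcases hzcl with hzU | hzfr
    · exact hzU
    · exact absurd hzfr (hcon r hr)
  exact hs (hsub ⟨s, right_mem_uIcc, rfl⟩)

/-! ## The covering of `(U ∩ Q) × (Q ∖ U)` by the path sets -/

/-- **`(U ∩ Q) × (Q ∖ U)` is covered by the path sets**: for `x ∈ U ∩ Q` and `y ∈ Q ∖ U` some step `j` of the
coordinate path switches, the `j`-th coordinate segment meets `frontier U` inside `Q`, and the frontier point
has the same `j`-deleted coordinates as the `j`-th path point. [folklore] -/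
theorem prod_subset_iUnion {U : Set (Fin (n + 1) → ℝ)} (hU : IsOpen U) (a b : Fin (n + 1) → ℝ) :
    (U ∩ Icc a b) ×ˢ (Icc a b \ U) ⊆ ⋃ j : Fin (n + 1),
      {z : (Fin (n + 1) → ℝ) × (Fin (n + 1) → ℝ) |
          Fin.removeNth j (fun i : Fin (n + 1) => if (i : ℕ) < (j : ℕ) then z.2 i else z.1 i) ∈
            Fin.removeNth j '' (frontier U ∩ Icc a b)} ∩ Icc a b ×ˢ Icc a b := by
  classical
  set p : ℕ → (Fin (n + 1) → ℝ) → (Fin (n + 1) → ℝ) → (Fin (n + 1) → ℝ) :=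
    fun j x y i => if (i : ℕ) < j then y i else x i with hpdef
  have hp : ∀ j x y i, p j x y i = if (i : ℕ) < j then y i else x i := fun _ _ _ _ => rfl
  rintro ⟨x, y⟩ ⟨⟨hxU, hxQ⟩, hyQ, hyU⟩
  obtain ⟨j, hjU, hjU'⟩ := exists_switch p hp hxU hyU
  rw [path_succ_eq_update p hp] at hjU'
  obtain ⟨r, hr, hfr⟩ := exists_mem_frontier_update hU hjU j hjU'
  have hpQ : p j x y ∈ Icc a b := path_mem_Icc p hp hxQ hyQ j
  -- the frontier point lies in the box
  have hrQ : update (p j x y) j r ∈ Icc a b := by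
    rw [mem_Icc, Pi.le_def, Pi.le_def] at hpQ hyQ ⊢
    have hr' : r ∈ Icc (a j) (b j) := by
      refine uIcc_subset_Icc ⟨hpQ.1 j, hpQ.2 j⟩ ⟨hyQ.1 j, hyQ.2 j⟩ hr
    refine ⟨fun i => ?_, fun i => ?_⟩
    · by_cases hij : i = j
      · subst hij; rw [update_self]; exact hr'.1
      · rw [update_of_ne hij]; exact hpQ.1 i
    · by_cases hij : i = j
      · subst hij; rw [update_self]; exact hr'.2
      · rw [update_of_ne hij]; exact hpQ.2 i
  refine mem_iUnion.2 ⟨j, ?_, ⟨hxQ, hyQ⟩⟩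
  refine ⟨update (p j x y) j r, ⟨hfr, hrQ⟩, ?_⟩
  rw [Fin.removeNth_update]

/-! ## The measure of a path set -/

section Measure

/-- The `j`-th path point and its complement as ONE map of the pair space: swap the first `j` coordinates of
`x` and `y`. It preserves Lebesgue measure on `(Fin (n+1) → ℝ)²`: transported along `arrowProdEquivProdArrow`
it is the coordinatewise map "swap if `i < j`" on `Fin (n+1) → ℝ × ℝ` (`volume_preserving_pi`). [folklore] -/
theorem measurePreserving_pathSwap (j : ℕ) :
    MeasurePreserving (fun z : (Fin (n + 1) → ℝ) × (Fin (n + 1) → ℝ) =>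
      ((fun i : Fin (n + 1) => if (i : ℕ) < j then z.2 i else z.1 i),
        (fun i : Fin (n + 1) => if (i : ℕ) < j then z.1 i else z.2 i)))
      (volume : Measure ((Fin (n + 1) → ℝ) × (Fin (n + 1) → ℝ))) volume := by
  classical
  set Φ := MeasurableEquiv.arrowProdEquivProdArrow ℝ ℝ (Fin (n + 1)) with hΦ
  have hΦm : MeasurePreserving Φ volume volume :=
    volume_measurePreserving_arrowProdEquivProdArrow ℝ ℝ (Fin (n + 1))
  -- coordinatewise swap below `j`
  set σ : (Fin (n + 1) → ℝ × ℝ) → (Fin (n + 1) → ℝ × ℝ) :=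
    fun f i => (fun (i : Fin (n + 1)) (q : ℝ × ℝ) => if (i : ℕ) < j then q.swap else q) i (f i) with hσ
  have hσm : MeasurePreserving σ volume volume := by
    refine volume_preserving_pi (f := fun (i : Fin (n + 1)) (q : ℝ × ℝ) => if (i : ℕ) < j then q.swap else q)
      fun i => ?_
    by_cases hi : (i : ℕ) < j
    · simp only [hi, if_true]
      have h : MeasurePreserving (Prod.swap : ℝ × ℝ → ℝ × ℝ) volume volume := by
        have h1 := (Measure.measurePreserving_swap (μ := (volume : Measure ℝ)) (ν := (volume : Measure ℝ)))
        rwa [← Measure.volume_eq_prod] at h1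
      exact h
    · simp only [hi, if_false]
      exact MeasurePreserving.id volume
  have hcomp : (fun z : (Fin (n + 1) → ℝ) × (Fin (n + 1) → ℝ) =>
      ((fun i : Fin (n + 1) => if (i : ℕ) < j then z.2 i else z.1 i),
        (fun i : Fin (n + 1) => if (i : ℕ) < j then z.1 i else z.2 i))) = Φ ∘ σ ∘ Φ.symm := by
    funext z
    ext i
    · simp only [comp_apply, hΦ, MeasurableEquiv.arrowProdEquivProdArrow, hσ]
      by_cases hi : (i : ℕ) < j <;> simp [hi, Equiv.arrowProdEquivProdArrow, MeasurableEquiv.coe_mk]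
    · simp only [comp_apply, hΦ, MeasurableEquiv.arrowProdEquivProdArrow, hσ]
      by_cases hi : (i : ℕ) < j <;> simp [hi, Equiv.arrowProdEquivProdArrow, MeasurableEquiv.coe_mk]
  rw [hcomp]
  exact hΦm.comp (hσm.comp hΦm.symm)

/-- **Measure of the box points with `j`-deleted coordinates in `A`**:
`vol {w ∈ Icc a b | removeNth j w ∈ A} ≤ (b j - a j) · volₙ(A)` (split off the `j`-th coordinate,
`volume_preserving_piFinSuccAbove`). [folklore] -/
theorem volume_box_removeNth_le (a b : Fin (n + 1) → ℝ) (j : Fin (n + 1)) (A : Set (Fin n → ℝ)) :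
    volume ({w : Fin (n + 1) → ℝ | Fin.removeNth j w ∈ A} ∩ Icc a b) ≤
      ENNReal.ofReal (b j - a j) * volume A := by
  classical
  set e := MeasurableEquiv.piFinSuccAbove (fun _ : Fin (n + 1) => ℝ) j with he
  have hem : MeasurePreserving e volume volume := volume_preserving_piFinSuccAbove (fun _ => ℝ) j
  have hsub : {w : Fin (n + 1) → ℝ | Fin.removeNth j w ∈ A} ∩ Icc a b ⊆
      e ⁻¹' (Icc (a j) (b j) ×ˢ A) := by
    rintro w ⟨hwA, hwQ⟩
    rw [mem_Icc, Pi.le_def, Pi.le_def] at hwQ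
    refine ⟨⟨hwQ.1 j, hwQ.2 j⟩, ?_⟩
    simpa [he, MeasurableEquiv.piFinSuccAbove] using hwA
  calc volume ({w : Fin (n + 1) → ℝ | Fin.removeNth j w ∈ A} ∩ Icc a b)
      ≤ volume (e ⁻¹' (Icc (a j) (b j) ×ˢ A)) := measure_mono hsub
    _ = volume (Icc (a j) (b j) ×ˢ A) := hem.measure_preimage_equiv _
    _ = volume (Icc (a j) (b j)) * volume A := by
        rw [Measure.volume_eq_prod, Measure.prod_prod]
    _ = ENNReal.ofReal (b j - a j) * volume A := by rw [Real.volume_Icc]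

/-- **Measure of a path set**: `vol(Cⱼ) ≤ (b j - a j) · volₙ(A) · vol(Icc a b)`, where `Cⱼ` is the set of
pairs of box points whose `j`-th path point has `j`-deleted coordinates in `A`.  The swap map of
`measurePreserving_pathSwap` carries `Cⱼ` into `{w ∈ Q | removeNth j w ∈ A} × Q`. [folklore] -/
theorem volume_pathSet_le (a b : Fin (n + 1) → ℝ) (j : Fin (n + 1)) {A : Set (Fin n → ℝ)}
    (hA : MeasurableSet A) :
    volume ({z : (Fin (n + 1) → ℝ) × (Fin (n + 1) → ℝ) |
        Fin.removeNth j (fun i : Fin (n + 1) => if (i : ℕ) < (j : ℕ) then z.2 i else z.1 i) ∈ A} ∩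
        Icc a b ×ˢ Icc a b) ≤
      ENNReal.ofReal (b j - a j) * volume A * volume (Icc a b) := by
  classical
  set p : ℕ → (Fin (n + 1) → ℝ) → (Fin (n + 1) → ℝ) → (Fin (n + 1) → ℝ) :=
    fun j x y i => if (i : ℕ) < j then y i else x i with hpdef
  have hp : ∀ j x y i, p j x y i = if (i : ℕ) < j then y i else x i := fun _ _ _ _ => rfl
  set T : (Fin (n + 1) → ℝ) × (Fin (n + 1) → ℝ) → (Fin (n + 1) → ℝ) × (Fin (n + 1) → ℝ) :=
    fun z => (p j z.1 z.2, p j z.2 z.1) with hT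
  have hTm : MeasurePreserving T volume volume := measurePreserving_pathSwap (n := n) j
  set A' : Set (Fin (n + 1) → ℝ) := {w | Fin.removeNth j w ∈ A} ∩ Icc a b with hA'
  -- the path set is contained in the preimage of `A' × Q` under the swap map
  have hsub : {z : (Fin (n + 1) → ℝ) × (Fin (n + 1) → ℝ) | Fin.removeNth j (p j z.1 z.2) ∈ A} ∩
      Icc a b ×ˢ Icc a b ⊆ T ⁻¹' (A' ×ˢ Icc a b) := by
    rintro ⟨x, y⟩ ⟨hzA, hxQ, hyQ⟩
    exact ⟨⟨hzA, path_mem_Icc p hp hxQ hyQ j⟩, path_mem_Icc p hp hyQ hxQ j⟩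
  have hAm' : MeasurableSet A' :=
    ((measurable_pi_iff.2 fun i => measurable_pi_apply _) hA).inter measurableSet_Icc
  calc volume ({z : (Fin (n + 1) → ℝ) × (Fin (n + 1) → ℝ) | Fin.removeNth j (p j z.1 z.2) ∈ A} ∩
        Icc a b ×ˢ Icc a b)
      ≤ volume (T ⁻¹' (A' ×ˢ Icc a b)) := measure_mono hsub
    _ = volume (A' ×ˢ Icc a b) :=
        hTm.measure_preimage (hAm'.prod measurableSet_Icc).nullMeasurableSet
    _ = volume A' * volume (Icc a b) := by rw [Measure.volume_eq_prod, Measure.prod_prod]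
    _ ≤ ENNReal.ofReal (b j - a j) * volume A * volume (Icc a b) := by
        gcongr
        exact volume_box_removeNth_le a b j A

/-- **Coordinate deletion is `1`-Lipschitz** for the sup norm. [folklore] -/
theorem lipschitzWith_removeNth (j : Fin (n + 1)) :
    LipschitzWith 1 (Fin.removeNth j : (Fin (n + 1) → ℝ) → (Fin n → ℝ)) := by
  refine LipschitzWith.of_dist_le_mul fun x y => ?_
  rw [NNReal.coe_one, one_mul, dist_pi_le_iff dist_nonneg]
  intro i
  exact dist_le_pi_dist x y (j.succAbove i)

/-- **The deleted shadow is smaller in measure**: `volₙ(removeNth j '' S) ≤ μH[n] S`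
(`1`-Lipschitz image, `hausdorffMeasure_pi_real`). [folklore] -/
theorem volume_image_removeNth_le_hausdorffMeasure (j : Fin (n + 1)) (S : Set (Fin (n + 1) → ℝ)) :
    volume (Fin.removeNth j '' S) ≤ μH[n] S := by
  have h1 : (volume : Measure (Fin n → ℝ)) = μH[n] := by
    rw [← hausdorffMeasure_pi_real, Fintype.card_fin]
  rw [h1]
  have h := (lipschitzWith_removeNth (n := n) j).hausdorffMeasure_image_le (d := n) (Nat.cast_nonneg n) S
  simpa using h

end Measure

/-! ## The telescoping inequality -/

/-- **Cube telescoping (weak relative isoperimetric inequality through the frontier).** For an open set `U`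
of `Fin (n+1) → ℝ` and a box `Q = Icc a b`:
`vol(U ∩ Q) · vol(Q ∖ U) ≤ vol(Q) · (∑ⱼ (bⱼ - aⱼ)) · μH[n](frontier U ∩ Q)`.
Proof: `prod_subset_iUnion` (every pair is in some path set), `volume_pathSet_le` (measure of a path set)
and `volume_image_removeNth_le_hausdorffMeasure` (the deleted shadow of the frontier).
[cite: Federer1969, 4.5.3] -/
theorem volume_inter_mul_volume_diff_le {U : Set (Fin (n + 1) → ℝ)} (hU : IsOpen U)
    (a b : Fin (n + 1) → ℝ) :
    volume (U ∩ Icc a b) * volume (Icc a b \ U) ≤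
      volume (Icc a b) * ((∑ j : Fin (n + 1), ENNReal.ofReal (b j - a j)) * μH[n] (frontier U ∩ Icc a b)) := by
  classical
  set S : Set (Fin (n + 1) → ℝ) := frontier U ∩ Icc a b with hS
  have hScpt : IsCompact S := (isCompact_Icc.inter_left isClosed_frontier)
  have hAm : ∀ j : Fin (n + 1), MeasurableSet (Fin.removeNth j '' S) := fun j =>
    (hScpt.image (lipschitzWith_removeNth j).continuous).isClosed.measurableSet
  calc volume (U ∩ Icc a b) * volume (Icc a b \ U)
      = volume ((U ∩ Icc a b) ×ˢ (Icc a b \ U)) := by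
        rw [Measure.volume_eq_prod, Measure.prod_prod]
    _ ≤ volume (⋃ j : Fin (n + 1),
          {z : (Fin (n + 1) → ℝ) × (Fin (n + 1) → ℝ) |
            Fin.removeNth j (fun i : Fin (n + 1) => if (i : ℕ) < (j : ℕ) then z.2 i else z.1 i) ∈
              Fin.removeNth j '' S} ∩ Icc a b ×ˢ Icc a b) := measure_mono (prod_subset_iUnion hU a b)
    _ ≤ ∑ j : Fin (n + 1), volume ({z : (Fin (n + 1) → ℝ) × (Fin (n + 1) → ℝ) |
            Fin.removeNth j (fun i : Fin (n + 1) => if (i : ℕ) < (j : ℕ) then z.2 i else z.1 i) ∈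
              Fin.removeNth j '' S} ∩ Icc a b ×ˢ Icc a b) := measure_iUnion_fintype_le _ _
    _ ≤ ∑ j : Fin (n + 1), ENNReal.ofReal (b j - a j) * volume (Fin.removeNth j '' S) * volume (Icc a b) :=
        Finset.sum_le_sum fun j _ => volume_pathSet_le a b j (hAm j)
    _ ≤ ∑ j : Fin (n + 1), ENNReal.ofReal (b j - a j) * μH[n] S * volume (Icc a b) := by
        gcongr with j
        exact volume_image_removeNth_le_hausdorffMeasure j S
    _ = volume (Icc a b) * ((∑ j : Fin (n + 1), ENNReal.ofReal (b j - a j)) * μH[n] S) := by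
        rw [Finset.sum_mul, Finset.mul_sum]
        refine Finset.sum_congr rfl fun j _ => ?_
        ring

end Summit.SmoothPoincare4.SmoothPoincare4.Theorems.CubeTelescoping

end
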